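import Summits.QuantumFields.YangMills.Theorems.BalabanUVNodesN15PartitionPeriodic
import Summits.QuantumFields.YangMills.Theorems.BalabanUVNodesN15BackgroundTupleCalculus
import HarnessLib

/-!
# THE QUADRATIC PARTITION OF UNITY (2.36), III: the LATTICE SAMPLING on ANY carrier `X` with one-step shifts `e_μ` and real coordinates `ξ_ν` moving by `s` (mod `K`) under `e_ν`:
# `h_k(x) = Π_ν Θ_K(ξ_ν(x) − k_ν)`, `k ∈ (ℤ∕K)^J` — `Σ_k h_k(x)² = 1` EXACTLY, `0 ≤ h_k ≤ 1`, and FILE 46's three partition letters `|∇_μh_k| ≤ |n|πs`, `|∇⁻_μh_k| ≤ |n|πs`,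
# `|∇*_μ∇_μh_k| ≤ n²·32π²s²` (with `s = 1∕(nM)`: `c₁ = π∕M`, `c₂ = 32π²∕M²`), plus the modulus of continuity `|h_k(x) − h_k(x′)| ≤ πΣ_ν|v_K(ξ_ν x − ξ_ν x′)|` FILE 56's `ℓ, ω` are read from
# (dag-n15-c g11, FILE 61; N15 = NE2, s1 «background-layer OPERATOR ingredient»)

Cell `pub-ymgap`, seat `pub-ymgap-dag-n15-c` (R134 (a); HUMAN RULING D-0062), generation 11.  `bears_on: R4∕N15 · K3⁷ SpineGivenEndpointR13SepCoPH (stmt-QuantumFields-20544)`.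
Filed `--supports stmt-QuantumFields-20544 --as helper` — COUNT-NEUTRAL.  One plumbing `def` (`hcube`; review-queued, D-0009), the rest theorems; 0 `sorry`.  Imports BY NAME FILE 60
`…N15PartitionPeriodic` (`thetaPer`, `sum_thetaPer_sq`, `abs_thetaPer_sub_le`, `abs_thetaPer_second_diff_le`, `thetaPer_add_int_mul`, `cenRep`) and g8 FILE 1 `…N15BackgroundTupleCalculus`
(`fgrad`, `bgrad`, `fgradAdj`, `*_apply`); nothing in the tree is modified.

WHY.  FILES 45–58 take the partition ABSTRACTLY: `h : K → X → ℝ` with `Σ_i h_i(x)² = 1`, `|h_i| ≤ 1`, `|fgrad n (e μ) (h i) x| ≤ c₁`, `|bgrad …| ≤ c₁`, `|fgradAdj n (e μ) (fgrad n (e μ) (h i)) x| ≤ c₂`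
(FILE 46∕49∕52∕53), block oscillation∕Lipschitz `ω, ℓ` (FILE 56).  THIS FILE CONSTRUCTS it on any carrier with the printed shape ([B6] (2.36) p.229: cubes of side `~M`, `Σh² = 1`, `|∂^αh| ≤
O(1)M^{−|α|}`): `hcube K ξ k x := Π_ν Θ_K(ξ_ν x − k_ν)` for coordinates `ξ : J → X → ℝ`, `k : J → ZMod K`; ★★★ `sum_hcube_sq` (`Σ_k h_k² = 1`: `Π_νΣ_{k_ν} = Σ_kΠ_ν` + FILE 60
`sum_thetaPer_sq`); `hcube_nonneg`, `hcube_le_one`; `abs_prod_sub_prod_le` (`|Πa − Πa′| ≤ Σ|a_ν − a′_ν|` for factors in `[0, 1]`); ★★ `abs_hcube_sub_le` (modulus of continuity through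
the circle distances `|v_K(ξ_ν x − ξ_ν x′)|` — FILE 56's `ℓ`, `ω` for any block geometry); under the SHIFT COMPATIBILITY `ξ_ν(e_μ x) ≡ ξ_ν(x) + δ_{νμ}s (mod K)`: `hcube_shift` ∕ `hcube_shift_symm`
(the sampled values at `e_μ^{±1}x` are the one-coordinate moves `±s`), ★★ `abs_fgrad_hcube_le` ∕ `abs_bgrad_hcube_le` (`≤ |n|π|s|`), ★★★ `abs_fgradAdj_fgrad_hcube_le` (`≤ n²·32π²s²`,
`0 ≤ s ≤ 1`) — FILE 46's `hh1`, `hh1b`, `hh2` DISCHARGED for this partition with `c₁ = |n|πs`, `c₂ = 32π²n²s²`; ★★ `abs_hcube_sub_hcube_le` — the two-grid fit `o` of the VALUES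
(FILE 45's `hfit`) between two coordinate systems on two carriers.

HONEST FRAMING ∕ LIMITS.  Elementary; (2.36) p.229 = the printed requirement; the coordinates `ξ_ν` and their shift compatibility are the consumer's torus data (displayed hypotheses —
e.g. `ξ_ν(x) = x_ν∕(cube side)` on `(ℤ∕N)^d`); the two-grid fit of the DERIVATIVES (`o₁`, `o₂` of FILE 46) is NOT in this file (the fit `o` of the values is `abs_hcube_sub_hcube_le`).  Nothing of [B6]∕[B9] asserted.  NE2⁺ NOT PRINTED, NOT proved; N15
NOT discharged; counts of record UNMOVED (typed 28∕28 · discharged 5∕27); one finite 𝕋⁴ at fixed ε — NOT infinite volume, NOT OS on ℝ⁴, NOT a mass gap, NOT Clay; R4 closes the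
conditional finite-𝕋⁴ rung `BalabanLadder.UV` only.  Restate-immune (no Theses import).
-/

noncomputable section

namespace Summit.QuantumFields.YangMills.BalabanUVNodes.N15.Gluing

open Real
open Summit.QuantumFields.YangMills.BalabanUVNodes.N15.BackgroundLayer (fgrad fgradAdj bgrad fgrad_apply fgradAdj_apply bgrad_apply)

section Lattice

variable {X : Type} {J : Type} [Fintype J] [DecidableEq J] (K : ℕ) (ξ : J → X → ℝ)

/-- **THE SAMPLED QUADRATIC PARTITION**: `h_k(x) = Π_ν Θ_K(ξ_ν(x) − k_ν)`, `k ∈ (ℤ∕K)^J`. [cite: Balaban1984PropagatorsII, (2.36) p.229 (shape)] -/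
def hcube (k : J → ZMod K) (x : X) : ℝ := ∏ ν, thetaPer K (ξ ν x - ((k ν).val : ℝ))

omit [DecidableEq J] in
/-- `0 ≤ h_k`. [folklore] -/
theorem hcube_nonneg (k : J → ZMod K) (x : X) : 0 ≤ hcube K ξ k x := Finset.prod_nonneg fun _ _ => thetaPer_nonneg K _

omit [DecidableEq J] in
/-- `h_k ≤ 1`. [folklore] -/
theorem hcube_le_one (k : J → ZMod K) (x : X) : hcube K ξ k x ≤ 1 :=
  Finset.prod_le_one (fun _ _ => thetaPer_nonneg K _) fun _ _ => (le_abs_self _).trans (abs_thetaPer_le_one K _)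

omit [DecidableEq J] in
/-- `|h_k| ≤ 1` (FILE 45's `hh`). [folklore] -/
theorem abs_hcube_le_one (k : J → ZMod K) (x : X) : |hcube K ξ k x| ≤ 1 := by
  rw [abs_of_nonneg (hcube_nonneg K ξ k x)]; exact hcube_le_one K ξ k x

/-- ★★★ **`Σ_k h_k(x)² = 1` EXACTLY** (FILE 45's `h236`), `K ≥ 2`. [cite: Balaban1984PropagatorsII, (2.36) p.229] -/
theorem sum_hcube_sq [NeZero K] (hK : 2 ≤ K) (x : X) : ∑ k : J → ZMod K, hcube K ξ k x ^ 2 = 1 := by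
  have key : ∏ ν : J, ∑ j : ZMod K, thetaPer K (ξ ν x - (j.val : ℝ)) ^ 2 = ∑ k : J → ZMod K, ∏ ν, thetaPer K (ξ ν x - ((k ν).val : ℝ)) ^ 2 := by
    rw [Finset.prod_univ_sum (fun _ => Finset.univ) (fun ν (j : ZMod K) => thetaPer K (ξ ν x - (j.val : ℝ)) ^ 2), Fintype.piFinset_univ]
  simp only [hcube, ← Finset.prod_pow]
  rw [← key]
  exact Finset.prod_eq_one fun ν _ => sum_thetaPer_sq hK (ξ ν x)

omit [Fintype J] in
/-- `|Πa − Πa′| ≤ Σ|a_ν − a′_ν|` for factors in `[0, 1]`. [folklore] -/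
theorem abs_prod_sub_prod_le (s : Finset J) (a a' : J → ℝ) (ha : ∀ ν, 0 ≤ a ν ∧ a ν ≤ 1) (ha' : ∀ ν, 0 ≤ a' ν ∧ a' ν ≤ 1) :
    |∏ ν ∈ s, a ν - ∏ ν ∈ s, a' ν| ≤ ∑ ν ∈ s, |a ν - a' ν| := by
  induction s using Finset.induction_on with
  | empty => simp
  | insert μ s hμ ih =>
      rw [Finset.prod_insert hμ, Finset.prod_insert hμ, Finset.sum_insert hμ]
      have hP : 0 ≤ ∏ ν ∈ s, a ν ∧ ∏ ν ∈ s, a ν ≤ 1 := ⟨Finset.prod_nonneg fun ν _ => (ha ν).1, Finset.prod_le_one (fun ν _ => (ha ν).1) fun ν _ => (ha ν).2⟩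
      calc |a μ * ∏ ν ∈ s, a ν - a' μ * ∏ ν ∈ s, a' ν| = |(a μ - a' μ) * ∏ ν ∈ s, a ν + a' μ * (∏ ν ∈ s, a ν - ∏ ν ∈ s, a' ν)| := by ring_nf
        _ ≤ |(a μ - a' μ) * ∏ ν ∈ s, a ν| + |a' μ * (∏ ν ∈ s, a ν - ∏ ν ∈ s, a' ν)| := abs_add_le _ _
        _ ≤ |a μ - a' μ| + ∑ ν ∈ s, |a ν - a' ν| := by
          rw [abs_mul, abs_mul, abs_of_nonneg hP.1, abs_of_nonneg (ha' μ).1]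
          exact add_le_add (mul_le_of_le_one_right (abs_nonneg _) hP.2) ((mul_le_of_le_one_left (abs_nonneg _) (ha' μ).2).trans ih)

omit [DecidableEq J] in
/-- ★★ **MODULUS OF CONTINUITY** (FILE 56's `ℓ`, `ω` for any block geometry): `|h_k(x) − h_k(x′)| ≤ π·Σ_ν |v_K(ξ_ν x − ξ_ν x′)|` — the circle distance of the coordinates, `K ≥ 1`. [folklore] -/
theorem abs_hcube_sub_le (hK : 0 < K) (k : J → ZMod K) (x x' : X) : |hcube K ξ k x - hcube K ξ k x'| ≤ π * ∑ ν, |cenRep K (ξ ν x - ξ ν x')| := by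
  classical
  unfold hcube
  refine (abs_prod_sub_prod_le Finset.univ _ _ (fun ν => ⟨thetaPer_nonneg K _, (le_abs_self _).trans (abs_thetaPer_le_one K _)⟩)
    (fun ν => ⟨thetaPer_nonneg K _, (le_abs_self _).trans (abs_thetaPer_le_one K _)⟩)).trans ?_
  rw [Finset.mul_sum]
  refine Finset.sum_le_sum fun ν _ => ?_
  -- move the second argument by the integer multiple of K closest to the difference
  have hper := thetaPer_add_int_mul hK (ξ ν x' - ((k ν).val : ℝ)) (round ((ξ ν x - ξ ν x') / K))
  rw [← hper]
  refine (abs_thetaPer_sub_le hK _ _).trans (le_of_eq ?_)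
  unfold cenRep; congr 1; congr 1; ring

omit [DecidableEq J] in
/-- ★★ **THE TWO-GRID FIT** (FILE 45's `hfit`): two coordinate systems `ξ` on `X` and `ξ₂` on `X₂` (e.g. fine `ξ′` and coarse `ξ∘π`) give `|h_k(x) − h_k(x₂)| ≤ π·Σ_ν |v_K(ξ_ν x − ξ₂,ν x₂)|` — so
`|h′_k(x′) − h_k(πx′)| ≤ π·|J|·ε` when fine and coarse coordinates of a fine point and its block differ by `≤ ε` on the circle. [cite: Balaban1985BackgroundPropagators, Thm 3.14 pp.426–427 (difference template: shape)] -/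
theorem abs_hcube_sub_hcube_le {X₂ : Type} (ξ₂ : J → X₂ → ℝ) (hK : 0 < K) (k : J → ZMod K) (x : X) (x₂ : X₂) :
    |hcube K ξ k x - hcube K ξ₂ k x₂| ≤ π * ∑ ν, |cenRep K (ξ ν x - ξ₂ ν x₂)| := by
  classical
  unfold hcube
  refine (abs_prod_sub_prod_le Finset.univ _ _ (fun ν => ⟨thetaPer_nonneg K _, (le_abs_self _).trans (abs_thetaPer_le_one K _)⟩)
    (fun ν => ⟨thetaPer_nonneg K _, (le_abs_self _).trans (abs_thetaPer_le_one K _)⟩)).trans ?_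
  rw [Finset.mul_sum]
  refine Finset.sum_le_sum fun ν _ => ?_
  have hper := thetaPer_add_int_mul hK (ξ₂ ν x₂ - ((k ν).val : ℝ)) (round ((ξ ν x - ξ₂ ν x₂) / K))
  rw [← hper]
  refine (abs_thetaPer_sub_le hK _ _).trans (le_of_eq ?_)
  unfold cenRep; congr 1; congr 1; ring

variable (e : J → X ≃ X) {s : ℝ}

/-- Under the shift compatibility, the sample at `e_μ x` is the one-coordinate move `+s`. [folklore] -/
theorem hcube_shift (hK : 0 < K) (hξ : ∀ μ ν x, ∃ z : ℤ, ξ ν (e μ x) = ξ ν x + (if ν = μ then s else 0) + z * K) (k : J → ZMod K) (μ : J) (x : X) :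
    hcube K ξ k (e μ x) = ∏ ν, thetaPer K (ξ ν x + (if ν = μ then s else 0) - ((k ν).val : ℝ)) := by
  unfold hcube
  refine Finset.prod_congr rfl fun ν _ => ?_
  obtain ⟨z, hz⟩ := hξ μ ν x
  rw [hz, show ξ ν x + (if ν = μ then s else 0) + z * K - ((k ν).val : ℝ) = (ξ ν x + (if ν = μ then s else 0) - ((k ν).val : ℝ)) + z * K by ring, thetaPer_add_int_mul hK]

/-- … and at `e_μ⁻¹ x` the move `−s`. [folklore] -/
theorem hcube_shift_symm (hK : 0 < K) (hξ : ∀ μ ν x, ∃ z : ℤ, ξ ν (e μ x) = ξ ν x + (if ν = μ then s else 0) + z * K) (k : J → ZMod K) (μ : J) (x : X) :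
    hcube K ξ k ((e μ).symm x) = ∏ ν, thetaPer K (ξ ν x - (if ν = μ then s else 0) - ((k ν).val : ℝ)) := by
  unfold hcube
  refine Finset.prod_congr rfl fun ν _ => ?_
  obtain ⟨z, hz⟩ := hξ μ ν ((e μ).symm x)
  rw [Equiv.apply_symm_apply] at hz
  have hz' : ξ ν ((e μ).symm x) = (ξ ν x - (if ν = μ then s else 0) - ((k ν).val : ℝ)) + (-z : ℤ) * K + ((k ν).val : ℝ) := by push_cast; linarith
  rw [hz', show (ξ ν x - (if ν = μ then s else 0) - ((k ν).val : ℝ)) + (-z : ℤ) * K + ((k ν).val : ℝ) - ((k ν).val : ℝ) =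
    (ξ ν x - (if ν = μ then s else 0) - ((k ν).val : ℝ)) + (-z : ℤ) * K by ring, thetaPer_add_int_mul hK]

/-- Splitting off the factor `μ`: `Π_ν Θ_K(ξ_ν + δ_{νμ}c − k_ν) = Θ_K(ξ_μ + c − k_μ) · Π_{ν ≠ μ} Θ_K(ξ_ν − k_ν)`. [folklore] -/
theorem prod_shift_eq (k : J → ZMod K) (μ : J) (x : X) (c : ℝ) :
    ∏ ν, thetaPer K (ξ ν x + (if ν = μ then c else 0) - ((k ν).val : ℝ)) =
      thetaPer K (ξ μ x + c - ((k μ).val : ℝ)) * ∏ ν ∈ Finset.univ.erase μ, thetaPer K (ξ ν x - ((k ν).val : ℝ)) := by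
  rw [← Finset.mul_prod_erase Finset.univ _ (Finset.mem_univ μ), if_pos rfl]
  congr 1
  exact Finset.prod_congr rfl fun ν hν => by rw [if_neg (Finset.ne_of_mem_erase hν), add_zero]

/-- The same with `−c`. [folklore] -/
theorem prod_shift_eq' (k : J → ZMod K) (μ : J) (x : X) (c : ℝ) :
    ∏ ν, thetaPer K (ξ ν x - (if ν = μ then c else 0) - ((k ν).val : ℝ)) =
      thetaPer K (ξ μ x - c - ((k μ).val : ℝ)) * ∏ ν ∈ Finset.univ.erase μ, thetaPer K (ξ ν x - ((k ν).val : ℝ)) := by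
  rw [← Finset.mul_prod_erase Finset.univ _ (Finset.mem_univ μ), if_pos rfl]
  congr 1
  exact Finset.prod_congr rfl fun ν hν => by rw [if_neg (Finset.ne_of_mem_erase hν), sub_zero]

/-- The complementary product is in `[0, 1]`. [folklore] -/
theorem prod_erase_mem (k : J → ZMod K) (μ : J) (x : X) :
    0 ≤ ∏ ν ∈ Finset.univ.erase μ, thetaPer K (ξ ν x - ((k ν).val : ℝ)) ∧ ∏ ν ∈ Finset.univ.erase μ, thetaPer K (ξ ν x - ((k ν).val : ℝ)) ≤ 1 :=
  ⟨Finset.prod_nonneg fun _ _ => thetaPer_nonneg K _, Finset.prod_le_one (fun _ _ => thetaPer_nonneg K _) fun _ _ => (le_abs_self _).trans (abs_thetaPer_le_one K _)⟩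

/-- The unshifted sample split at `μ`. [folklore] -/
theorem hcube_eq_mul (k : J → ZMod K) (μ : J) (x : X) :
    hcube K ξ k x = thetaPer K (ξ μ x - ((k μ).val : ℝ)) * ∏ ν ∈ Finset.univ.erase μ, thetaPer K (ξ ν x - ((k ν).val : ℝ)) := by
  rw [hcube, ← Finset.mul_prod_erase Finset.univ _ (Finset.mem_univ μ)]

/-- ★★ **FILE 46's `hh1` DISCHARGED**: `|∇_μ h_k(x)| = |n|·|h_k(e_μx) − h_k(x)| ≤ |n|π|s|`. [cite: Balaban1984PropagatorsII, (2.36) p.229 («|∂h_□| ≤ O(1)M⁻¹»)] -/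
theorem abs_fgrad_hcube_le (hK : 0 < K) (hξ : ∀ μ ν x, ∃ z : ℤ, ξ ν (e μ x) = ξ ν x + (if ν = μ then s else 0) + z * K) (n : ℝ) (k : J → ZMod K) (μ : J) (x : X) :
    |fgrad n (e μ) (hcube K ξ k) x| ≤ |n| * (π * |s|) := by
  rw [fgrad_apply, abs_mul]
  refine mul_le_mul_of_nonneg_left ?_ (abs_nonneg _)
  rw [hcube_shift K ξ e hK hξ, prod_shift_eq, hcube_eq_mul K ξ k μ x, ← sub_mul, abs_mul, abs_of_nonneg (prod_erase_mem K ξ k μ x).1]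
  refine (mul_le_of_le_one_right (abs_nonneg _) (prod_erase_mem K ξ k μ x).2).trans ?_
  refine (abs_thetaPer_sub_le hK _ _).trans (le_of_eq ?_)
  rw [show ξ μ x + s - ((k μ).val : ℝ) - (ξ μ x - ((k μ).val : ℝ)) = s by ring]

/-- ★★ **FILE 46's `hh1b` DISCHARGED**: `|∇⁻_μ h_k(x)| ≤ |n|π|s|`. [cite: Balaban1984PropagatorsII, (2.36) p.229] -/
theorem abs_bgrad_hcube_le (hK : 0 < K) (hξ : ∀ μ ν x, ∃ z : ℤ, ξ ν (e μ x) = ξ ν x + (if ν = μ then s else 0) + z * K) (n : ℝ) (k : J → ZMod K) (μ : J) (x : X) :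
    |bgrad n (e μ) (hcube K ξ k) x| ≤ |n| * (π * |s|) := by
  rw [bgrad_apply, abs_mul]
  refine mul_le_mul_of_nonneg_left ?_ (abs_nonneg _)
  rw [hcube_shift_symm K ξ e hK hξ, prod_shift_eq', hcube_eq_mul K ξ k μ x, ← sub_mul, abs_mul, abs_of_nonneg (prod_erase_mem K ξ k μ x).1]
  refine (mul_le_of_le_one_right (abs_nonneg _) (prod_erase_mem K ξ k μ x).2).trans ?_
  refine (abs_thetaPer_sub_le hK _ _).trans (le_of_eq ?_)
  rw [show ξ μ x - ((k μ).val : ℝ) - (ξ μ x - s - ((k μ).val : ℝ)) = s by ring]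

/-- ★★★ **FILE 46's `hh2` DISCHARGED**: `|∇*_μ∇_μ h_k(x)| = n²·|h_k(e_μx) − 2h_k(x) + h_k(e_μ⁻¹x)| ≤ n²·32π²s²` for `0 ≤ s ≤ 1`, `K ≥ 2`. [cite: Balaban1984PropagatorsII, (2.36) p.229 («|∂²h_□| ≤ O(1)M⁻²»)] -/
theorem abs_fgradAdj_fgrad_hcube_le (hK : 2 ≤ K) (hξ : ∀ μ ν x, ∃ z : ℤ, ξ ν (e μ x) = ξ ν x + (if ν = μ then s else 0) + z * K) (hs : 0 ≤ s) (hs1 : s ≤ 1) (n : ℝ)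
    (k : J → ZMod K) (μ : J) (x : X) : |fgradAdj n (e μ) (fgrad n (e μ) (hcube K ξ k)) x| ≤ n ^ 2 * (32 * π ^ 2 * s ^ 2) := by
  have hK0 : 0 < K := by omega
  rw [fgradAdj_apply, fgrad_apply, fgrad_apply, Equiv.apply_symm_apply, hcube_shift K ξ e hK0 hξ, prod_shift_eq, hcube_shift_symm K ξ e hK0 hξ, prod_shift_eq',
    hcube_eq_mul K ξ k μ x]
  have hPm := prod_erase_mem K ξ k μ x
  have key := abs_thetaPer_second_diff_le (u := ξ μ x - ((k μ).val : ℝ)) hK hs hs1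
  rw [show ξ μ x - ((k μ).val : ℝ) + s = ξ μ x + s - ((k μ).val : ℝ) by ring, show ξ μ x - ((k μ).val : ℝ) - s = ξ μ x - s - ((k μ).val : ℝ) by ring] at key
  have eq : n * (n * (thetaPer K (ξ μ x - ((k μ).val : ℝ)) * ∏ ν ∈ Finset.univ.erase μ, thetaPer K (ξ ν x - ((k ν).val : ℝ)) -
        thetaPer K (ξ μ x - s - ((k μ).val : ℝ)) * ∏ ν ∈ Finset.univ.erase μ, thetaPer K (ξ ν x - ((k ν).val : ℝ))) -
      n * (thetaPer K (ξ μ x + s - ((k μ).val : ℝ)) * ∏ ν ∈ Finset.univ.erase μ, thetaPer K (ξ ν x - ((k ν).val : ℝ)) -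
        thetaPer K (ξ μ x - ((k μ).val : ℝ)) * ∏ ν ∈ Finset.univ.erase μ, thetaPer K (ξ ν x - ((k ν).val : ℝ)))) =
      -(n ^ 2 * ((thetaPer K (ξ μ x + s - ((k μ).val : ℝ)) - 2 * thetaPer K (ξ μ x - ((k μ).val : ℝ)) + thetaPer K (ξ μ x - s - ((k μ).val : ℝ))) *
        ∏ ν ∈ Finset.univ.erase μ, thetaPer K (ξ ν x - ((k ν).val : ℝ)))) := by ring
  rw [eq, abs_neg, abs_mul, abs_mul, abs_of_nonneg (sq_nonneg n), abs_of_nonneg hPm.1]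
  refine mul_le_mul_of_nonneg_left ?_ (sq_nonneg _)
  exact (mul_le_of_le_one_right (abs_nonneg _) hPm.2).trans key

end Lattice

end Summit.QuantumFields.YangMills.BalabanUVNodes.N15.Gluing

end
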